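import Summits.QuantumFields.YangMills.Theorems.BalabanUVNodesN07Thm4RecMemberOfCrown
import HarnessLib

/-!
# N07 [B11] (= [15] = [Balaban1985Variational]) Sect. F — **THE PRINT DATUM MEETS THE RECORD CROWN's p. 98 SIDE CONDITIONS AND DENT PREMISE**
# (the crown-TEXT-independent half of the adapter «record crown (N05-REC R6) → `DatumCrownAt`»)

Cell `pub-ymgap`, width seat `pub-ymgap-dag-n07-w3` g12 (N05-REC R7 → THE KNIT; LEAD PEN of N05-REC = dag-n05-e).  `--kind proof --supports stmt-QuantumFields-20541 --as helper`
(K0⁷; count-neutral).  Theorems only (no `def`, no `instance`, no `notation`, no `sorry`).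
[6] = [Balaban1985RegularSpaces]; [15] = [Balaban1985Variational]; [I] = [Balaban1987RG1].

WHY.  The knit of record (g11, p721358 `…N07Thm4RecMemberOfCrown`) leaves ONE displayed premise `DatumCrownAt F N Mc ρ hρ Cr α₁` = [6] Proposition 6's conclusion FOR THE
RECORD STRUCTURE at the print datum `c := propCubePZ (F.P K) j hj Mc ρ hρ idx` (a `Node00.CubeB8DZ` over the constant ambient family «`Ω ≡ □̃ᶻ`»), and p729805
(`…N07Thm4RecMemberPrintLetters`) reads it at every admissible collar `ρ := ρ₀·L`, `ρmin ∣ ρ₀`, with `Cr := 560·L³·B₀·M′`, `α₁ := c₁∕(28·L²·M′)`, `M′ = sideP (F.P 0) Mc ρ`.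
N05-REC's crown (dag-n05-e, the record twin of the engine theorem `B8Prop6DentedCubeMemberScalarGammaHolds.gaugedBoundB8D_dentedMember_scalar_γ_holds`) is quantified
over EVERY dented record datum `c : CubeB8DZ d L K Ω` subject to print's p. 98 SIDE CONDITIONS in the named facts' letters — `∀ s R, 3 ≤ Lˢ → M₀ ≤ L^{s+1} → L^{s+1} ∣ c.ρ →
L^{s+1} ∣ c.M → R·L^{s+1} ≤ c.ρ → 2L ≤ R → R₀ ≤ R → N₀ + 1 ≤ R·L^{s+1} → ρ₀ ≤ c.ρ` («□_j is a sum of the big blocks», «M is a multiple of R₁M₁ = R·Lˢ⁺¹») —, the DENT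
PREMISE «`Ω_k` is a union of cubes of side `L^{s+1}·Lᵏ` of the grid anchored at `□_k`'s fine lower corner `Lᵏ(c.a − c.ρ) − c_k·𝟙`» ([6] (1.4)₂, record anchor; the binder of
`B8Ineq159FlatDentedCubeMemberPrintedRec.Ineq159FlatDentedCubeMemberPrintedZ`), the unitarity of `U₀`, and the guard `7·d·L²·c.M·α₀ ≤ c₁`, with radius
`7·d·L²·(5dLB₀)·c.M·α₀`.  THIS FILE discharges these for the print datum, ONCE, independently of the crown's remaining text (its `u`-body and its two displayed (1.59)
facts): the adapter proper (next file) is then «instantiate, feed §2–§4, read off».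

WHAT IS PROVED (kernel; bookkeeping ∕ integer arithmetic only).
* §1 `mem_Icc_of_ediv_eq`, `inBox_of_blockMap_eq`, ★ `mem_tcubeZ_of_blockMap_eq` — a fine box whose side is a multiple of the grid step `G` is a union of the `G`-grid cubes
  anchored at any `p ≡` corner `(mod G)` (the EMPTY-dent premise at `Ω ≡ □̃ᶻ`).
* §2 ★ `dent_propCubePZ` — the crown's dent premise AT THE PRINT DATUM, in the crown's own letters (`blockMap (L^{s+1}·L^{c.k}) (x − (L^{c.k}·(c.a − c.ρ) − c_{c.k}·𝟙))`),
  from `L^{s+1} ∣ ρ` (the side `M′ = sideP` is a multiple of `ρ`).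
* §3 ★ `exists_collar_sideConditions` — for every threshold quadruple `(ρ₀, M₀, N₀, R₀)` of a crown and `L ≥ 3`: `∃ s ρmin, 1 ≤ ρmin ∧ ∀ ρ₀′, ρmin ∣ ρ₀′ → 1 ≤ ρ₀′ → ∀ Mc,
  ∃ R`, the nine side conditions at `c.ρ = ρ₀′·L`, `c.M = sideP P Mc (ρ₀′·L)` — the quantifier shape of p729805's `…_uniform_of_datumCrownAt_sideP`.
* §4 (the knit's letters, `F : T4Family`, `d = 4`) `sideP_P_eq` (`sideP (F.P K) = sideP (F.P 0)`), `guard_propCubePZ(')` (`α ≤ c₁∕(28·L²·M′) ⇒ 7·d·L²·c.M·α ≤ c₁`),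
  `radius_propCubePZ(')` (`7·d·L²·(5·d·L·B₀)·c.M·α = (560·L³·B₀·M′)·α`; unprimed: `d := 4`, `L := F.L` literal; primed: `(F.P K).d`, `(F.P K).L`), `ιSU_mem_unitaryUnits` ∕ `ιSU_mem_specialUnitaryUnits` ∕ `lift_mem_unitaryUnits` (the lifted `SU(N)`
  field is a unitary `U₀`).
HONEST FRAMING: count-neutral helpers; no inequality of [3]∕[4]∕[6]∕[15]∕[I] proved or asserted; `DatumCrownAt` (hence `HThm4RecMember`, `HThm4RecDbar`, `HThm4Rec`)
UNDISCHARGED (caveat (C-S3-1)); the crown itself is dag-n05-e's and, as announced, CONDITIONAL on two printed (1.59) facts for the record's linearised averaging and typed for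
UNITARY `u` (the `G := SU(N)` edition the junction needs is located on the cell bus, 2026-08-29 ⚑ LOCATED-SU-AT-JUNCTION); N05 ∕ N07 NOT discharged; K0⁷ ∕ K1⁹ NOT closed;
counts unmoved (typed 28∕28 · discharged 8∕27); one finite 𝕋⁴ programme at fixed ε — R4 closes the conditional finite-𝕋⁴ rung `BalabanLadder.UV` ONLY; the YM mass gap
(Clay) is NOT proved by any of this; nothing continuum ∕ ℝ⁴ ∕ OS.

References: [6] p. 98 («□_j is a sum of the big blocks», «M is a multiple of R₁M₁»), (1.4) p. 77, (1.130) p. 99, Prop. 6 (1.135)–(1.138) p. 99; [15] (144) p. 300,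
(148)–(152) p. 301; [I] (0.3)–(0.4) pp. 252–253.
-/

set_option autoImplicit false

noncomputable section

open scoped BigOperators Matrix.Norms.L2Operator

namespace Summit.QuantumFields.YangMills.BalabanUVNodes.N07DatumCrownSideConditions

open Literature.MathematicalPhysics.QuantumFieldTheory.Balaban1983to89
open Literature.MathematicalPhysics.QuantumFieldTheory.Balaban1983to89.Node00
open Literature.MathematicalPhysics.QuantumLattice (blockMap)
open B15Eq112TorusCover (cover)
open B14DomainGeom (Pt)
open B7Prop1Local (InBox)
open B7Prop2Explicit (unitaryUnits)
open B7Prop2SpecialUnitary (specialUnitaryUnits)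
open B8Ineq130Rec (tlo thi tlo_apply thi_apply)
open B8Eq131Cubes (tLo tHi)
open B8Eq131CubesRec (tcubeZ)
open BlockAveragingZd (ctrShift two_mul_ctrShift_add_one)
open T4Continuum (T4Family)

/-! ## §1  A fine box whose side is a multiple of the grid step is a union of grid cubes -/

section Grid

variable {d : ℕ}

/-- One coordinate: if `⌊(x − p)∕G⌋ = ⌊(y − p)∕G⌋`, `G ∣ p − lo`, `lo ≤ x ≤ hi` and `hi + 1 = lo + G·t`, then `lo ≤ y ≤ hi`.
[cite: Balaban1985RegularSpaces, (1.4) p.77 (bookkeeping: «Ω_j is a sum of the big blocks»)] -/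
theorem mem_Icc_of_ediv_eq {G : ℕ} (hG : 0 < G) {x y p lo hi : ℤ} {t : ℕ} (h : (x - p) / (G : ℤ) = (y - p) / (G : ℤ))
    (hp : (G : ℤ) ∣ p - lo) (hhi : hi + 1 = lo + (G : ℤ) * t) (hx : lo ≤ x ∧ x ≤ hi) : lo ≤ y ∧ y ≤ hi := by
  obtain ⟨m, hm⟩ := hp
  have hG' : (0 : ℤ) < (G : ℤ) := by exact_mod_cast hG
  -- shift the anchor from `p` to `lo`: `(z − p)/G + m = (z − lo)/G`
  have hshift : ∀ z : ℤ, (z - lo) / (G : ℤ) = (z - p) / (G : ℤ) + m := by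
    intro z
    have : z - lo = z - p + m * (G : ℤ) := by rw [show lo = p - (G : ℤ) * m by omega]; ring
    rw [this, Int.add_mul_ediv_right _ _ hG'.ne']
  have h' : (x - lo) / (G : ℤ) = (y - lo) / (G : ℤ) := by rw [hshift, hshift, h]
  set q := (x - lo) / (G : ℤ) with hq
  have hq0 : 0 ≤ q := Int.ediv_nonneg (by omega) hG'.le
  have hqt : q < t := by
    rw [hq, Int.ediv_lt_iff_lt_mul hG']
    have : x - lo < (G : ℤ) * t := by omega
    linarith [mul_comm (G : ℤ) (t : ℤ)]
  have hy1 : q * (G : ℤ) ≤ y - lo := by rw [h']; exact Int.ediv_mul_le _ hG'.ne'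
  have hy2 : y - lo < (q + 1) * (G : ℤ) := by rw [h']; exact Int.lt_ediv_add_one_mul_self _ hG'
  have hq1 : (q + 1) * (G : ℤ) ≤ (t : ℤ) * (G : ℤ) := mul_le_mul_of_nonneg_right (by omega) hG'.le
  constructor
  · nlinarith
  · nlinarith

/-- `d` coordinates: the box `[lo, hi]` with `hi + 1 = lo + G·t` (coordinatewise) is a union of the `G`-grid cubes anchored at any `p ≡ lo (mod G)`.
[cite: Balaban1985RegularSpaces, (1.4) p.77 (bookkeeping)] -/
theorem inBox_of_blockMap_eq {G : ℕ} (hG : 0 < G) {x y p lo hi : B7Prop1Explicit.Site d} {t : Fin d → ℕ}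
    (h : blockMap G (x - p) = blockMap G (y - p)) (hp : ∀ i, (G : ℤ) ∣ p i - lo i) (hhi : ∀ i, hi i + 1 = lo i + (G : ℤ) * t i)
    (hx : InBox lo hi x) : InBox lo hi y := fun i =>
  mem_Icc_of_ediv_eq hG (by simpa [blockMap] using congrFun h i) (hp i) (hhi i) (hx i)

/-- ★ **THE EMPTY-DENT PREMISE AT `Ω ≡ □̃ᶻ`**: `□̃ᶻ = tcubeZ L a M ρ k` (fine box `[Lᵏ(a − 2ρ) − c_k, Lᵏ(a + M + 2ρ) − c_k − 1]`, side `Lᵏ(M + 4ρ)`) is a union of the grid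
cubes of side `G` anchored at any `p` with `G ∣ p − (Lᵏ(a − 2ρ) − c_k)`, as soon as `G ∣ Lᵏ(M + 4ρ)` (odd `L`).
[cite: Balaban1985RegularSpaces, (1.4) p.77, p.98; Balaban1985Variational, (144) p.300; Balaban1987RG1, (0.3) p.252] -/
theorem mem_tcubeZ_of_blockMap_eq {L : ℕ} (hL : Odd L) {a : B7Prop1Explicit.Site d} {M ρ k G : ℕ} (hG : 0 < G) {t : ℕ}
    (ht : (L ^ k * (M + 4 * ρ) : ℕ) = G * t) {p : B7Prop1Explicit.Site d} (hp : ∀ i, (G : ℤ) ∣ p i - tlo L (tLo a ρ) k i) {x y : B7Prop1Explicit.Site d}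
    (h : blockMap G (x - p) = blockMap G (y - p)) (hx : x ∈ tcubeZ L a M ρ k) : y ∈ tcubeZ L a M ρ k := by
  refine inBox_of_blockMap_eq hG h hp (t := fun _ => t) (fun i => ?_) hx
  rw [tlo_apply hL, thi_apply hL]
  have h2 : (2 * ctrShift L k + 1 : ℤ) = (L : ℤ) ^ k := by exact_mod_cast two_mul_ctrShift_add_one hL k
  have ht' : ((L : ℤ) ^ k * (M + 4 * ρ) : ℤ) = (G : ℤ) * t := by exact_mod_cast ht
  simp only [tLo, tHi]
  linear_combination ht' + h2

end Grid

/-! ## §2  The crown's dent premise at the print datum -/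

section Dent

variable (P : Params)

/-- `M′ = sideP P Mc ρ` is a multiple of `ρ` («M is a multiple of R₁M₁»). [cite: Balaban1985RegularSpaces, p.98] -/
theorem dvd_sideP (Mc ρ : ℕ) : ρ ∣ sideP P Mc ρ := Dvd.intro _ rfl

/-- ★ **THE RECORD CROWN's DENT PREMISE AT THE PRINT DATUM** `c := propCubePZ P n hn Mc ρ hρ idx` (ambient family `Ω ≡ □̃ᶻ`), in the crown's own letters: if `L^{s+1} ∣ ρ`
then `□̃ᶻ` is a union of cubes of side `L^{s+1}·L^{c.k}` of the grid anchored at `L^{c.k}·(c.a − c.ρ) − c_{c.k}·𝟙` — the binder of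
`B8Ineq159FlatDentedCubeMemberPrintedRec.Ineq159FlatDentedCubeMemberPrintedZ` ∕ of the record crown, at the EMPTY dent.
[cite: Balaban1985RegularSpaces, (1.4) p.77, p.98; Balaban1985Variational, (144) p.300, (148)–(150) p.301; Balaban1987RG1, (0.3) p.252] -/
theorem dent_propCubePZ {n : ℕ} (hn : 1 ≤ n) {Mc ρ : ℕ} (hρ : P.L ≤ ρ) (idx : Pt P.d) {s : ℕ} (hdiv : P.L ^ (s + 1) ∣ ρ) :
    ∀ x y : B7Prop1Explicit.Site P.d,
      blockMap (P.L ^ (s + 1) * P.L ^ (propCubePZ P n hn Mc ρ hρ idx).k)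
          (x - fun i => (P.L : ℤ) ^ (propCubePZ P n hn Mc ρ hρ idx).k *
            ((propCubePZ P n hn Mc ρ hρ idx).a i - (propCubePZ P n hn Mc ρ hρ idx).ρ) - (ctrShift P.L (propCubePZ P n hn Mc ρ hρ idx).k : ℤ)) =
        blockMap (P.L ^ (s + 1) * P.L ^ (propCubePZ P n hn Mc ρ hρ idx).k)
          (y - fun i => (P.L : ℤ) ^ (propCubePZ P n hn Mc ρ hρ idx).k *
            ((propCubePZ P n hn Mc ρ hρ idx).a i - (propCubePZ P n hn Mc ρ hρ idx).ρ) - (ctrShift P.L (propCubePZ P n hn Mc ρ hρ idx).k : ℤ)) →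
      x ∈ (fun _ : ℕ => tcubeZ P.L (cornerP P Mc ρ idx) (sideP P Mc ρ) ρ n) (propCubePZ P n hn Mc ρ hρ idx).k →
      y ∈ (fun _ : ℕ => tcubeZ P.L (cornerP P Mc ρ idx) (sideP P Mc ρ) ρ n) (propCubePZ P n hn Mc ρ hρ idx).k := by
  intro x y h hx
  simp only [propCubePZ_k, propCubePZ_a, propCubePZ_ρ] at h hx ⊢
  have hLo : Odd P.L := P.hL.1
  have hL0 : 0 < P.L := P.L_pos
  obtain ⟨r, hr⟩ := hdiv
  obtain ⟨q, hq⟩ := dvd_sideP P Mc ρ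
  -- the side `Lⁿ(M′ + 4ρ)` is `(L^{s+1}·Lⁿ)·(r·(q + 4))`
  have hG : 0 < P.L ^ (s + 1) * P.L ^ n := by positivity
  refine mem_tcubeZ_of_blockMap_eq hLo hG (t := r * (q + 4)) ?_ (fun i => ?_) h hx
  · rw [hq, hr]; ring
  · rw [tlo_apply hLo]
    simp only [tLo]
    refine ⟨r, ?_⟩
    have : (ρ : ℤ) = (P.L : ℤ) ^ (s + 1) * r := by exact_mod_cast hr
    push_cast
    linear_combination ((P.L : ℤ) ^ n) * this

end Dent

/-! ## §3  Print's p. 98 side conditions at the collars `ρ = ρ₀′·L`, `ρmin ∣ ρ₀′` -/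

section SideConditions

variable (P : Params)

/-- ★ **THE NINE SIDE CONDITIONS OF THE RECORD CROWN AT THE PRINT DATUM, COLLAR-UNIFORMLY**: for every threshold quadruple `(ρ₀, M₀, N₀, R₀)` («there exist constants … such
that for R₁M₁ ≥ ρ₀, M_h = Lˢ ≥ M₀, …») and `L ≥ 3` there are an exponent `s` and a modulus `ρmin ≥ 1` such that at EVERY collar `ρ = ρ₀′·L` with `ρmin ∣ ρ₀′`, `ρ₀′ ≥ 1`, and
every grid side `Mc`, the datum `(c.ρ, c.M) = (ρ₀′·L, sideP P Mc (ρ₀′·L))` lies on print's big-block sub-lattice above threshold: `3 ≤ Lˢ`, `M₀ ≤ L^{s+1}`, `L^{s+1} ∣ c.ρ`,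
`L^{s+1} ∣ c.M`, `R·L^{s+1} ≤ c.ρ`, `2L ≤ R`, `R₀ ≤ R`, `N₀ + 1 ≤ R·L^{s+1}`, `ρ₀ ≤ c.ρ` for some `R` (namely `c.ρ = R·L^{s+1}` exactly).  Witness: `s` with `L^{s+1} ≥ M₀`,
`ρmin := Lˢ·max(2L, R₀, N₀ + 1, ⌈ρ₀⌉)`.  (The quantifier shape `∀ ρ₀′, ρmin ∣ ρ₀′ → 1 ≤ ρ₀′ → …` is p729805's `…_uniform_of_datumCrownAt_sideP`.)
[cite: Balaban1985RegularSpaces, p.98 («□_j is a sum of the big blocks», «M is a multiple of R₁M₁»), Thm. 4 p.88, Prop. 6 p.99; Balaban1985Variational, (144) p.300] -/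
theorem exists_collar_sideConditions (hL3 : 3 ≤ P.L) (ρ₀ M₀ : ℝ) (N₀ R₀ : ℕ) :
    ∃ s ρmin : ℕ, 1 ≤ ρmin ∧ ∀ ρ₀' : ℕ, ρmin ∣ ρ₀' → 1 ≤ ρ₀' → ∀ Mc : ℕ, ∃ R : ℕ,
      3 ≤ P.L ^ s ∧ M₀ ≤ (P.L : ℝ) ^ (s + 1) ∧ P.L ^ (s + 1) ∣ ρ₀' * P.L ∧ P.L ^ (s + 1) ∣ sideP P Mc (ρ₀' * P.L) ∧
        R * P.L ^ (s + 1) ≤ ρ₀' * P.L ∧ 2 * P.L ≤ R ∧ R₀ ≤ R ∧ N₀ + 1 ≤ R * P.L ^ (s + 1) ∧ ρ₀ ≤ ((ρ₀' * P.L : ℕ) : ℝ) := by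
  -- the exponent: `s := ⌈M₀⌉₊ + 1`, so that `L^{s+1} ≥ 2^{s+1} > s + 1 > ⌈M₀⌉₊ ≥ M₀` and `Lˢ ≥ L ≥ 3`
  set s : ℕ := ⌈M₀⌉₊ + 1 with hs
  -- the threshold factor
  set T : ℕ := max (2 * P.L) (max R₀ (max (N₀ + 1) ⌈ρ₀⌉₊)) with hT
  have hL1 : 1 ≤ P.L := by omega
  have hT1 : 1 ≤ T := le_trans (by omega) (le_max_left _ _)
  have hLs1 : 1 ≤ P.L ^ s := Nat.one_le_pow _ _ hL1
  refine ⟨s, P.L ^ s * T, Nat.le_mul_of_pos_right _ hT1 |>.trans' hLs1, fun ρ₀' hdvd hρ1 Mc => ?_⟩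
  obtain ⟨t, ht⟩ := hdvd
  have ht1 : 1 ≤ t := by
    rcases Nat.eq_zero_or_pos t with h0 | h0
    · rw [h0, mul_zero] at ht; omega
    · exact h0
  refine ⟨T * t, ?_, ?_, ?_, ?_, ?_, ?_, ?_, ?_, ?_⟩
  · -- `3 ≤ Lˢ`
    calc 3 ≤ P.L := hL3
      _ = P.L ^ 1 := (pow_one _).symm
      _ ≤ P.L ^ s := Nat.pow_le_pow_right hL1 (by omega)
  · -- `M₀ ≤ L^{s+1}`
    have h1 : M₀ ≤ (⌈M₀⌉₊ : ℝ) := Nat.le_ceil M₀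
    have h2 : (⌈M₀⌉₊ : ℝ) + 1 < (2 : ℝ) ^ (s + 1) := by
      have := Nat.lt_two_pow_self (n := s + 1)
      have h' : ((s + 1 : ℕ) : ℝ) < ((2 ^ (s + 1) : ℕ) : ℝ) := by exact_mod_cast this
      push_cast at h'
      simp only [hs] at h' ⊢; push_cast at h' ⊢; linarith
    have h3 : (2 : ℝ) ^ (s + 1) ≤ (P.L : ℝ) ^ (s + 1) :=
      pow_le_pow_left₀ (by norm_num) (by exact_mod_cast (by omega : 2 ≤ P.L)) _
    linarith
  · -- `L^{s+1} ∣ ρ₀′·L`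
    rw [ht]; exact ⟨T * t, by ring⟩
  · -- `L^{s+1} ∣ M′`
    exact dvd_trans (by rw [ht]; exact ⟨T * t, by ring⟩) (dvd_sideP P Mc (ρ₀' * P.L))
  · -- `R·L^{s+1} ≤ ρ₀′·L` (equality)
    rw [ht]; apply le_of_eq; ring
  · -- `2L ≤ R`
    calc 2 * P.L ≤ T := le_max_left _ _
      _ ≤ T * t := Nat.le_mul_of_pos_right _ ht1
  · -- `R₀ ≤ R`
    calc R₀ ≤ T := (le_max_left _ _).trans (le_max_right _ _)
      _ ≤ T * t := Nat.le_mul_of_pos_right _ ht1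
  · -- `N₀ + 1 ≤ R·L^{s+1}`
    calc N₀ + 1 ≤ T := ((le_max_left _ _).trans (le_max_right _ _)).trans (le_max_right _ _)
      _ ≤ T * t := Nat.le_mul_of_pos_right _ ht1
      _ ≤ T * t * P.L ^ (s + 1) := Nat.le_mul_of_pos_right _ (Nat.one_le_pow _ _ hL1)
  · -- `ρ₀ ≤ ρ₀′·L`
    have h1 : ρ₀ ≤ (⌈ρ₀⌉₊ : ℝ) := Nat.le_ceil ρ₀
    have h2 : ⌈ρ₀⌉₊ ≤ ρ₀' * P.L := by
      calc ⌈ρ₀⌉₊ ≤ T := ((le_max_right _ _).trans (le_max_right _ _)).trans (le_max_right _ _)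
        _ ≤ T * t := Nat.le_mul_of_pos_right _ ht1
        _ ≤ P.L ^ s * T * t := by rw [mul_assoc]; exact Nat.le_mul_of_pos_left _ hLs1
        _ = ρ₀' := ht.symm
        _ ≤ ρ₀' * P.L := Nat.le_mul_of_pos_right _ hL1
    have h3 : (⌈ρ₀⌉₊ : ℝ) ≤ ((ρ₀' * P.L : ℕ) : ℝ) := by exact_mod_cast h2
    linarith

end SideConditions

/-! ## §4  The knit's letters (`F : T4Family`, `d = 4`): guard, radius, unitarity of the lift -/

section Knit

variable (F : T4Family) (N : ℕ) [NeZero N]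

/-- The print side does not depend on `K` (it reads only `d = 4`). [cite: Balaban1985RegularSpaces, p.98 (bookkeeping)] -/
theorem sideP_P_eq (K Mc ρ : ℕ) : sideP (F.P K) Mc ρ = sideP (F.P 0) Mc ρ := by
  unfold sideP; rw [T4Family.P_d, T4Family.P_d]

/-- **THE GUARD**: at a tolerance `α ≤ α₁ := c₁ ∕ (28·L²·M′)` the crown's guard «`7·d·L²·c.M·α ≤ c₁`» holds at the print datum (`d = 4`, `c.M = M′ = sideP (F.P 0) Mc ρ`;
stated in the letters the record crown produces at `d := 4`, `L := F.L`). [cite: Balaban1985RegularSpaces, Prop. 6 p.99 («for α₀ sufficiently small»), (1.130) p.99] -/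
theorem guard_propCubePZ {K j : ℕ} (hj : 1 ≤ j) {Mc ρ : ℕ} (hρ : F.L ≤ ρ) (idx : Pt (F.P K).d) {c₁ α : ℝ}
    (hα : α ≤ c₁ / (28 * (F.L : ℝ) ^ 2 * (sideP (F.P 0) Mc ρ : ℝ))) :
    7 * ((4 : ℕ) : ℝ) * (F.L : ℝ) ^ 2 * ((propCubePZ (F.P K) j hj Mc ρ hρ idx).M : ℝ) * α ≤ c₁ := by
  rw [propCubePZ_M, sideP_P_eq]
  have hL1 : (1 : ℝ) ≤ F.L := by exact_mod_cast (F.P 0).L_pos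
  have hρ0 : 0 < ρ := lt_of_lt_of_le (F.P 0).L_pos hρ
  have hsd : (1 : ℝ) ≤ (sideP (F.P 0) Mc ρ : ℝ) := by
    have h := le_sideP (P := F.P 0) Mc hρ0
    exact_mod_cast (show 1 ≤ sideP (F.P 0) Mc ρ by omega)
  have hD : 0 < 28 * (F.L : ℝ) ^ 2 * (sideP (F.P 0) Mc ρ : ℝ) := by positivity
  have := (le_div_iff₀ hD).1 hα
  push_cast
  nlinarith

/-- The same guard in the generic letters `(F.P K).d`, `(F.P K).L` (definitionally `4`, `F.L`). [cite: Balaban1985RegularSpaces, Prop. 6 p.99, (1.130) p.99] -/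
theorem guard_propCubePZ' {K j : ℕ} (hj : 1 ≤ j) {Mc ρ : ℕ} (hρ : F.L ≤ ρ) (idx : Pt (F.P K).d) {c₁ α : ℝ}
    (hα : α ≤ c₁ / (28 * (F.L : ℝ) ^ 2 * (sideP (F.P 0) Mc ρ : ℝ))) :
    7 * ((F.P K).d : ℝ) * ((F.P K).L : ℝ) ^ 2 * ((propCubePZ (F.P K) j hj Mc ρ hρ idx).M : ℝ) * α ≤ c₁ := by
  exact guard_propCubePZ F hj hρ idx hα

/-- **THE RADIUS**: the crown's radius «`7·d·L²·(5dLB₀)·c.M·α`» at the print datum is p729805's `Cr·α` with `Cr := 560·L³·B₀·M′` (`d = 4`; the letters the record crown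
produces at `d := 4`, `L := F.L`). [cite: Balaban1985RegularSpaces, Prop. 6 (1.135)–(1.136) p.99] -/
theorem radius_propCubePZ {K j : ℕ} (hj : 1 ≤ j) {Mc ρ : ℕ} (hρ : F.L ≤ ρ) (idx : Pt (F.P K).d) (B₀ α : ℝ) :
    7 * ((4 : ℕ) : ℝ) * (F.L : ℝ) ^ 2 * (5 * ((4 : ℕ) : ℝ) * (F.L : ℝ) * B₀) * ((propCubePZ (F.P K) j hj Mc ρ hρ idx).M : ℝ) * α =
      (560 * (F.L : ℝ) ^ 3 * B₀ * (sideP (F.P 0) Mc ρ : ℝ)) * α := by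
  rw [propCubePZ_M, sideP_P_eq]
  push_cast
  ring

/-- The same radius identity in the generic letters `(F.P K).d`, `(F.P K).L`. [cite: Balaban1985RegularSpaces, Prop. 6 (1.135)–(1.136) p.99] -/
theorem radius_propCubePZ' {K j : ℕ} (hj : 1 ≤ j) {Mc ρ : ℕ} (hρ : F.L ≤ ρ) (idx : Pt (F.P K).d) (B₀ α : ℝ) :
    7 * ((F.P K).d : ℝ) * ((F.P K).L : ℝ) ^ 2 * (5 * ((F.P K).d : ℝ) * (F.P K).L * B₀) * ((propCubePZ (F.P K) j hj Mc ρ hρ idx).M : ℝ) * α =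
      (560 * (F.L : ℝ) ^ 3 * B₀ * (sideP (F.P 0) Mc ρ : ℝ)) * α := by
  exact radius_propCubePZ F hj hρ idx B₀ α

omit [NeZero N] in
/-- The embedded `SU(N)` matrix is a unitary unit of `M_N(ℂ)`. [cite: Balaban1987RG1, pp.251–252 («G ⊂ U(N)»)] -/
theorem ιSU_mem_unitaryUnits (g : SU N) :
    letI : CStarAlgebra (MatA N) := {}
    ιSU N g ∈ unitaryUnits (MatA N) := by
  letI : CStarAlgebra (MatA N) := {}
  exact B7Prop2Explicit.mem_unitaryUnits.mpr (by rw [coe_ιSU]; exact Matrix.specialUnitaryGroup_le_unitaryGroup g.2)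

omit [NeZero N] in
/-- The embedded `SU(N)` matrix is a special-unitary unit. [cite: Balaban1987RG1, pp.251–252] -/
theorem ιSU_mem_specialUnitaryUnits (g : SU N) : ιSU N g ∈ specialUnitaryUnits (Fin N) := by
  rw [B7Prop2SpecialUnitary.mem_specialUnitaryUnits, coe_ιSU]; exact g.2

omit [NeZero N] in
/-- **THE LIFT IS A UNITARY `U₀`**: the top-anchored lift `x μ ↦ ιSU (U (π(x + c_j·𝟙), μ))` of an `SU(N)` torus field is unitary-valued (the crown's binder
`∀ x κ, U₀ x κ ∈ unitaryUnits 𝔸`). [cite: Balaban1985RegularSpaces, p.98; Balaban1987RG1, pp.251–253] -/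
theorem lift_mem_unitaryUnits {K : ℕ} (U : GaugeField (F.P K) 0 (SU N)) (j : ℕ) :
    letI : CStarAlgebra (MatA N) := {}
    ∀ (x : B7Prop1Explicit.Site (F.P K).d) (κ : Fin (F.P K).d),
      (fun x μ => ιSU N (U ⟨cover (F.P K) (x + fun _ => (ctrShift (F.P K).L j : ℤ)), μ⟩)) x κ ∈ unitaryUnits (MatA N) :=
  fun _ _ => ιSU_mem_unitaryUnits N _

end Knit

end Summit.QuantumFields.YangMills.BalabanUVNodes.N07DatumCrownSideConditions

end
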